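/-
Copyright: lit-balaban cell, Phase-2 proof seat p30 (gen 35).  Statement-level skeleton of a published paper; no proof claims beyond
what the kernel checks below.
-/
import Literature.MathematicalPhysics.QuantumFieldTheory.BalabanImbrieJaffe1984to88.BIJ88Eq44OneStroke
import Literature.MathematicalPhysics.QuantumFieldTheory.BalabanImbrieJaffe1984to88.BIJ85CovariantHiggsDictionary
import Literature.MathematicalPhysics.QuantumFieldTheory.BalabanImbrieJaffe1984to88.BIJ88BgInvariance416Torus
import Literature.MathematicalPhysics.QuantumFieldTheory.BalabanImbrieJaffe1984to88.BIJ85Claim73SecondForm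
import Literature.MathematicalPhysics.QuantumFieldTheory.BalabanImbrieJaffe1984to88.BIJ85SigmaTranslationInvariance
import Literature.MathematicalPhysics.QuantumFieldTheory.Balaban1983to89.T4Covariance
import Literature.MathematicalPhysics.QuantumFieldTheory.Balaban1983to89.B4Eq15Projection

/-!
# `BalabanImbrieJaffe1984to88.BIJ88Eq44CornerCentre` — T. Bałaban, J. Imbrie, A. Jaffe, *Effective action and cluster properties of
the abelian Higgs model*, Commun. Math. Phys. **114** (1988) 257–315 [BalabanImbrieJaffe1988], (4.4) p. 274 [PDF 18] *"ū_{k,b} =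
u_k(⟨b₋, b₊⟩)"*, with [BalabanImbrieJaffe1985] (2.4) p. 302 [PDF 4] *"y = Ln denotes a corner of a block"*: **THE CORNER ↔ CENTRE
HALF-BLOCK TRANSLATION DICTIONARY between the two typed `k`-fold line products of the tree** — r18's `BIJ88Sect4Statements.barU k`
(straight lines between the block CENTRES `emb`/`embIter` of `Setup`, the [Balaban1987RG1] (0.1) convention; cell DIVERGENCE F3) and
print's corner lines, p11's `BIJ85BlockAveragesTorusK.lineIter U k` = `BIJ88BgInvariance416Torus.barUc k U` — PROVED: they differ
EXACTLY by the translation of the fine field by the constant vector `((L^k − 1)/2, …, (L^k − 1)/2)`.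

statement-level skeleton of published theorems with citation tags; proofs where landed; nothing here is a claim about the Yang–Mills mass gap

PDF held: `paper:balaban1988-cmp114-bij-abelian-higgs-effective-action` (journal page = PDF page + 256), p. 274 [PDF 18] (4.4);
`paper:balaban1985-cmp97-bij-higgs-minimizers` (journal page = PDF page + 298), p. 302–303 [PDF 4–5] (2.4)–(2.6), (2.10).

CITATION HEADER (lean-in-tree rule).  Part of the lit-balaban TYPED SKELETON (HOME `run/shared/lean/pub/lit-balaban/`), Phase 2, seat
p30 gen 35 (unit `lit-balaban-p30-g35`; TAKING line HOME/STATUS.md 2026-08-23T16:48:56Z, free-target protocol G.5-34(d)).  LOCATED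
MEMBER (zero head weight) for rows **C2.Eq4.4** (owner r18; decl of record `BIJ88Sect4Statements.barU`), **C2.Eq3.11** / the (5.1.1)
record (p34's `qCov (barU k u_k) ·`) versus **C1.Eq6.1-6.4** (p30 gen 33's `BIJ85Eq61MeanFieldRT.Step61.qH = qCov (lineIter u_k k) ·`), and
the cell's DIVERGENCE F3 (`Setup.emb` centre vs print's corner; C1.Eq2.4).  It answers r18 gen 28's note (3) to p30 gen 33 (*"one
dictionary line `lineIter` ↔ `barU` (or a remark that none exists yet)"*) and the NOT-DONE items of `BIJ88Eq44OneStroke` (*"the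
corner-anchored variant … differs from the centred one by a conjugation-free relabelling of the line"*), `BIJ88BgInvariance416Torus`
(*"r18's `barU` is the same product between the block CENTRES — DIVERGENCE F3; not used here"*) and `BIJ85LineSumCentre` (*"the bridge
corner ↔ centre is NOT claimed"*, for the line PRODUCTS; p11's line-SUM defect is a different object).

THE PRINT, verbatim.  [BalabanImbrieJaffe1988] p. 274: *"The configuration u_k on T_η gives a configuration ū_k on T₁^{(k)} by taking a
product along the bond in T₁^{(k)}, i.e., ū_{k,b} = u_k(⟨b₋, b₊⟩). (4.4)"*.  [BalabanImbrieJaffe1985] p. 302: *"imbed the unit lattice in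
an L-lattice of block B(y). Here y = Ln denotes a corner of a block, and n ∈ ℤ^d. Then B(y) consists of points x = (x₁, …, x_d) such
that y_j ≦ x_j < y_j + L, j = 1, 2, …, d. (2.4)"*; p. 303: *"For a point y′ which is a corner of an adjacent block, let Γ_{yy′} denote
the L-lattice bond from y to y′"*, *"Γ_{yy′} = b′"* (2.10).  So in print the sites of `T₁^{(k)}` ARE sites of `T_η` (the block corners)
and `⟨b₋, b₊⟩` is the straight run of `L^k` η-bonds from the corner `b₋`; the tree's `Setup` (`blockOf`, `emb`) represents a coarse site
by the CENTRE of its block instead ([Balaban1987RG1] (0.1), `L` odd) — the two straight runs are translates of each other by half a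
block in EVERY direction.

WHAT IS PROVED (kernel-checked, 0 `sorry`, standard axioms; ONE definition with body — the half-diagonal vector `halfDiag` — and theorems;
no `def … : Prop`).  Carriers of record only (`Setup` tori `Site P j`, bonds `PBond P j`, `GaugeField P j G`; translations
`TorusLimitAxioms.GaugeField.translate`, `(τ_a u)(b) = u(⟨b₋ + a, μ⟩)`; r18's `corner`/`runSite`/`runBond`/`runC`; p11's `lineU`/`lineIter`/
`runProd`/`cornerIter`; `AveragingRT.axialAvg`/`pathProd`/`lineSite`; the T4 cell's `T4Covariance` scaling `Site.scale a = L·a` with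
`Site.emb_add`, `AveragingRT.axialAvg_translate`, `GaugeField.translate_zero`; p33's level transport `BIJ85Claim73SecondForm.lvl`).  NO
standing-range hypothesis anywhere (the cross-level scaling is additive on every torus of `Setup`, `T4Covariance`).
* §1 `halfDiag P j n = ((n−1)/2, …, (n−1)/2) ∈ T^{(j)}`; **`emb_eq_corner_add_halfDiag`** `emb y = corner y + halfDiag L`; **`corner_eq_scale`**
  (r18's `corner` IS the T4 cell's `Site.scale`: label `L·y`); `corner_add` (`corner (y + a) = corner y + corner a` — a coarse translation by
  `a` is the fine translation by `corner a`), `emb_add`, `cornerIter_add`, `corner_natConst`/`cornerIter_natConst`, `runBond_translate` (r18's `runSite_add`),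
  **`lineSite_eq_runSite_corner`** (`AveragingRT.lineSite c t = runSite (corner c₋) μ t + halfDiag L`),
  `cornerIter_halfDiag_add_halfDiag` (`L^k·(L−1)/2 + (L^k−1)/2 = (L^{k+1}−1)/2` as fine vectors), **`embIter_eq_cornerIter_add_halfDiag`**
  (`B4Eq15Projection.embIter k y = cornerIter k y + halfDiag (L^k)`: the centre of `B^k(y)` is its corner plus the half diagonal).
* §2 ONE LEVEL, every `j`, no casts: **`axialAvg_eq_lineU_translate`** `axialAvg u = lineU (τ_{halfDiag L} u)` (`U(1)`), `cornerLine_eq_lineU`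
  and **`barUc_eq_lineIter`** (`barUc k u = lineIter u k` — the two typed corner iterates coincide).
* §3 TRANSLATION COVARIANCE of the corner line maps (twins of the T4 cell's centred `AveragingRT.axialAvg_translate` /
  `T4Continuum.iter_translate`): `lineU_translate` (`lineU (τ_{corner a} u) = τ_a (lineU u)`), `axialAvg_translate_corner` (any gauge group),
  **`lineIter_translate`** (`lineIter (τ_{cornerIter k a} u) k = τ_a (lineIter u k)`).
* §4 THE `k`-FOLD DICTIONARY (4.4): **`barU_eq_lvl_lineIter`** — for every `U(1)` field `u` on `T_η` and every `k`,
  `barU k u = lvl (Nat.zero_add k) (lineIter (τ_{halfDiag (L^k)} u) k)`; equivalently `barU k u = lvl _ (barUc k (τ_{halfDiag (L^k)} u))`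
  (`barU_eq_lvl_barUc`); `lvl` evaluated (`lvl_apply`, `barU_apply_eq_lineIter`).
* §5 read at the level `0 + k`: `lineIter_translate_halfDiag_apply` (`lineIter (τ_{halfDiag (L^k)}u) k b′ = barU k u (b′ read at level k)`), and
  for r18's covariant block average (2.6) **`qCov_barU_eq_qCov_lineIter_translate`**: p34's (3.11)/(5.1.1) record `qCov (barU k u_k) φ` = the
  (6.1) shape `qCov (lineIter · k) ·` of p30 gen 33's `Step61.qH` at the TRANSLATED background `τ_{halfDiag (L^k)}u_k` (scalar field and coarse
  site read through the level casts, r13's `siteK` shape).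
HONEST SCOPE / READING.  Print's object ((4.4) with [BalabanImbrieJaffe1985] (2.4)) is the CORNER product `lineIter`/`barUc`; `barU` is
its reading in the tree's centred block convention (F3).  Consequently p34's (5.1.1)/(3.11) record `qCov (barU k u_k) φ` and p30 gen 33's
(6.1) record `qCov (lineIter u_k k) φ` are the same functional of the background AFTER translating the η-lattice background by
`halfDiag (L^k)` (and transporting levels `0 + k ↔ k` by `lvl`); they are NOT asserted to be equal at the same `u_k` (they are not, in
general: the phase factor of the actual background (4.5.4) is not translation invariant under sub-block translations).  No SKELETON
head moves by this file.  `L` odd throughout (`Params.hL`); no standing-range hypothesis is used (beyond `m + K` the tori of `Setup`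
degenerate but the identities hold verbatim).
-/

namespace Literature.MathematicalPhysics.QuantumFieldTheory.BalabanImbrieJaffe1984to88.BIJ88Eq44CornerCentre

open Literature.MathematicalPhysics.QuantumFieldTheory.Balaban1983to89
open BIJ88Sect3Statements (U1 toC toC_mul toC_one)
open BIJ88Sect3Rescaling (toC_injective_U1)
open BIJ85BlockAveragesTorus (corner val_corner runSite runBond runC corner_shift)
open BIJ85BlockAveragesTorusK (lineU lineIter runProd toC_lineU cornerIter lineIter_zero lineIter_succ cornerIter_zero cornerIter_succ)
open BIJ88Sect4Statements (barU)
open BIJ88Eq44OneStroke (barU_succ)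
open BIJ88BgInvariance416Torus (barUc cornerLine toC_cornerLine barUc_zero barUc_succ)
open BIJ85Claim73SecondForm (lvl)
open BIJ85SigmaTranslationInvariance (runSite_add)
open AveragingRT (axialAvg pathProd line lineSite)
open scoped BigOperators

noncomputable section

variable {P : Params} {j : ℕ}

/-! ## §1 The half-diagonal vector and the geometry of corners and centres -/

/-- **the half diagonal of an `n`-block**: the constant vector `((n−1)/2, …, (n−1)/2)` of `T^{(j)}` — for `n = L^k` the offset from the
CORNER `y = L^kn` of the block `B^k(y)` ([BalabanImbrieJaffe1985] (2.4) *"y = Ln denotes a corner of a block"*) to its CENTRE (the tree's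
`Setup.emb`/`embIter`, [Balaban1987RG1] (0.1); `L` odd). [cite: BalabanImbrieJaffe1985, (2.4) p.302] -/
def halfDiag (P : Params) (j n : ℕ) : Balaban1983to89.Site P j := fun _ => (((n - 1) / 2 : ℕ) : ZMod (P.sitesPerDir j))

/-- kernel: the coordinates of the half diagonal. [cite: BalabanImbrieJaffe1985, (2.4) p.302] -/
theorem halfDiag_apply (n : ℕ) (κ : Fin P.d) : halfDiag P j n κ = (((n - 1) / 2 : ℕ) : ZMod (P.sitesPerDir j)) := rfl

/-- kernel: a `1`-block is a point — its half diagonal vanishes. [cite: BalabanImbrieJaffe1985, (2.4) p.302] -/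
theorem halfDiag_one : halfDiag P j 1 = 0 := by
  funext κ
  rw [halfDiag_apply, Nat.sub_self, Nat.zero_div, Nat.cast_zero]
  rfl

/-- kernel: r18's corner in coordinates, `(corner y)_κ = L·y_κ` as a residue. [cite: BalabanImbrieJaffe1985, (2.4) p.302] -/
theorem corner_apply (y : Balaban1983to89.Site P (j + 1)) (κ : Fin P.d) :
    corner y κ = (((y κ).val * P.L : ℕ) : ZMod (P.sitesPerDir j)) := by
  show ((((y κ).val * P.L + ((⟨0, P.L_pos⟩ : Fin P.L) : ℕ) : ℕ) : ZMod (P.sitesPerDir j))) = _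
  rw [Fin.val_mk, add_zero]

/-- **THE CENTRE IS THE CORNER PLUS THE HALF DIAGONAL**: `Setup.emb y = corner y + halfDiag L` — the tree's representative of the coarse
site `y` (label `Ly + (L−1)/2`, [Balaban1987RG1] (0.1)) versus print's (label `Ly`, (2.4)). [cite: BalabanImbrieJaffe1985, (2.4) p.302] -/
theorem emb_eq_corner_add_halfDiag (y : Balaban1983to89.Site P (j + 1)) : emb y = corner y + halfDiag P j P.L := by
  funext κ
  rw [Site.add_apply, corner_apply, halfDiag_apply, ← Nat.cast_add]
  rfl

/-- **r18's `corner` IS the T4 cell's cross-level scaling `Site.scale`** (`a ↦ L·a : T^{(j+1)} → T^{(j)}`, an additive homomorphism,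
`T4Covariance`): the corner of the block of `y` is the fine vector of label `L·y`. [cite: BalabanImbrieJaffe1985, (2.4) p.302] -/
theorem corner_eq_scale (y : Balaban1983to89.Site P (j + 1)) : corner y = Site.scale y := by
  funext κ
  rw [corner_apply, Site.scale_apply, Site.scaleCoord_apply]

/-- **a coarse translation is a fine translation by `L` times the vector**: `corner (y + a) = corner y + corner a` — `corner a` is the
fine vector of label `L·a` (every level, no range hypothesis: `Site.scale` is additive). [cite: BalabanImbrieJaffe1985, (2.4) p.302] -/
theorem corner_add (y a : Balaban1983to89.Site P (j + 1)) : corner (y + a) = corner y + corner a := by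
  rw [corner_eq_scale, corner_eq_scale, corner_eq_scale, map_add]

/-- kernel: the same for the centres, `emb (y + a) = emb y + corner a`. [cite: BalabanImbrieJaffe1985, (2.4) p.302] -/
theorem emb_add (y a : Balaban1983to89.Site P (j + 1)) : emb (y + a) = emb y + corner a := by
  rw [corner_eq_scale, Site.emb_add]

/-- kernel: the iterated corner is additive, `cornerIter k (y + a) = cornerIter k y + cornerIter k a`.
[cite: BalabanImbrieJaffe1985, (2.4) p.302] -/
theorem cornerIter_add : ∀ (k : ℕ) (y a : Balaban1983to89.Site P (j + k)),
    cornerIter k (y + a) = cornerIter k y + cornerIter k a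
  | 0, _, _ => rfl
  | k + 1, y, a => by
    rw [cornerIter_succ, cornerIter_succ, cornerIter_succ, corner_add, cornerIter_add k]

/-- kernel: the corner of a constant coarse vector of label `n` is the constant fine vector of label `n·L`. [cite: BalabanImbrieJaffe1985, (2.4) p.302] -/
theorem corner_natConst (n : ℕ) :
    corner (fun _ : Fin P.d => (n : ZMod (P.sitesPerDir (j + 1)))) = fun _ => ((n * P.L : ℕ) : ZMod (P.sitesPerDir j)) := by
  funext κ
  rw [corner_apply, ZMod.val_natCast]
  exact Site.natCast_mul_L_eq_of_modEq P j (Nat.mod_modEq _ _)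

/-- kernel: … iterated, label `n·L^k`. [cite: BalabanImbrieJaffe1985, (2.4) p.302] -/
theorem cornerIter_natConst : ∀ (k : ℕ) (n : ℕ),
    cornerIter k (fun _ : Fin P.d => (n : ZMod (P.sitesPerDir (j + k)))) = fun _ => ((n * P.L ^ k : ℕ) : ZMod (P.sitesPerDir j))
  | 0, n => by
    funext κ
    rw [cornerIter_zero, pow_zero, mul_one]
  | k + 1, n => by
    rw [cornerIter_succ, corner_natConst, cornerIter_natConst k, pow_succ, mul_comm (P.L ^ k) P.L, mul_assoc]

/-- kernel (odd arithmetic): `(L−1)/2·L^k + (L^k−1)/2 = (L^{k+1}−1)/2` for odd `L`. [cite: BalabanImbrieJaffe1985, (2.4) p.302] -/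
theorem half_pred_mul_pow_add {L : ℕ} (hL : Odd L) (k : ℕ) : (L - 1) / 2 * L ^ k + (L ^ k - 1) / 2 = (L ^ (k + 1) - 1) / 2 := by
  obtain ⟨b, hb⟩ : Odd (L ^ k) := hL.pow
  obtain ⟨a, ha⟩ := hL
  have h1 : (L - 1) / 2 = a := by omega
  have h2 : (L ^ k - 1) / 2 = b := by omega
  have h3 : L ^ (k + 1) = 2 * (a * (2 * b + 1) + b) + 1 := by
    rw [pow_succ, hb, ha]
    ring
  rw [h1, h2, hb, h3]
  generalize a * (2 * b + 1) + b = X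
  omega

/-- **the half diagonals compose across levels**: the corner image of the level-`(j+k)` half diagonal of an `L`-block plus the half
diagonal of an `L^k`-block is the half diagonal of an `L^{k+1}`-block — `L^k·(L−1)/2 + (L^k−1)/2 = (L^{k+1}−1)/2` coordinatewise
(`L` odd). [cite: BalabanImbrieJaffe1985, (2.4) p.302] -/
theorem cornerIter_halfDiag_add_halfDiag (k : ℕ) :
    cornerIter k (halfDiag P (j + k) P.L) + halfDiag P j (P.L ^ k) = halfDiag P j (P.L ^ (k + 1)) := by
  rw [show halfDiag P (j + k) P.L = fun _ : Fin P.d => (((P.L - 1) / 2 : ℕ) : ZMod (P.sitesPerDir (j + k))) from rfl,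
    cornerIter_natConst k]
  funext κ
  rw [Site.add_apply, halfDiag_apply, halfDiag_apply, ← Nat.cast_add, half_pred_mul_pow_add P.hL.1]

/-- kernel: a fine translation commutes with the run bonds — the `τ_a`-image of `⟨x + te_μ, μ⟩` is `⟨(x + a) + te_μ, μ⟩` (r18's
`BIJ85SigmaTranslationInvariance.runSite_add` on bonds). [cite: BalabanImbrieJaffe1985, (2.10) p.303] -/
theorem runBond_translate (x a : Balaban1983to89.Site P j) (μ : Fin P.d) (t : ℕ) :
    (runBond x μ t).translate a = runBond (x + a) μ t := by
  -- r18's `BIJ85BlockAveragesTorus.runSite` and `LatticeFieldCalculus.runSite` have the same body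
  have h : runSite (x + a) μ t = runSite x μ t + a := runSite_add x a μ t
  rw [runBond, runBond, h]
  rfl

/-- **the centred line is the corner line shifted by the half diagonal**: the `t`-th site `emb y + te_μ` of `AveragingRT`'s line of the
coarse bond `c = ⟨y, μ⟩` is `corner y + te_μ + halfDiag L`, the `t`-th site of print's run `Γ_{yy′}` (2.10) translated.
[cite: BalabanImbrieJaffe1985, (2.10) p.303] -/
theorem lineSite_eq_runSite_corner (c : PBond P (j + 1)) (t : ℕ) :
    lineSite c t = runSite (corner c.src) c.dir t + halfDiag P j P.L := by
  have h : runSite (corner c.src + halfDiag P j P.L) c.dir t = runSite (corner c.src) c.dir t + halfDiag P j P.L :=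
    runSite_add _ _ _ _
  rw [← h, ← emb_eq_corner_add_halfDiag]
  rfl

/-- **THE CENTRE OF `B^k(y)` IS ITS CORNER PLUS THE HALF DIAGONAL OF AN `L^k`-BLOCK**: `embIter k y = cornerIter k y + halfDiag (L^k)` (the
level-generic iterate `B4Eq15Projection.embIter`; every `k`). [cite: BalabanImbrieJaffe1985, (2.4) p.302] -/
theorem embIter_eq_cornerIter_add_halfDiag : ∀ (k : ℕ) (y : Balaban1983to89.Site P (j + k)),
    B4Eq15Projection.embIter k y = cornerIter k y + halfDiag P j (P.L ^ k)
  | 0, y => by rw [B4Eq15Projection.embIter_zero, cornerIter_zero, pow_zero, halfDiag_one, add_zero]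
  | k + 1, y => by
    rw [B4Eq15Projection.embIter_succ, embIter_eq_cornerIter_add_halfDiag k, emb_eq_corner_add_halfDiag,
      cornerIter_add k, cornerIter_succ, add_assoc, cornerIter_halfDiag_add_halfDiag k]

/-! ## §2 One level: the centred straight-line product is the corner product of the translated field -/

/-- kernel: translating the field translates the base point of p11's ordered run products. [cite: BalabanImbrieJaffe1985, (2.5) p.302] -/
theorem runProd_translate (U : GaugeField P j U1) (x a : Balaban1983to89.Site P j) (μ : Fin P.d) :
    ∀ n : ℕ, runProd (U.translate a) x μ n = runProd U (x + a) μ n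
  | 0 => rfl
  | n + 1 => by
    rw [runProd, runProd, runProd_translate U x a μ n, GaugeField.translate_apply, runBond_translate]

/-- kernel: the `n`-th bond of `AveragingRT`'s centred line of `c` is the `τ_{halfDiag L}`-translate of the `n`-th bond of print's run
from the corner. [cite: BalabanImbrieJaffe1985, (2.10) p.303] -/
theorem runBond_corner_translate_halfDiag (c : PBond P (j + 1)) (n : ℕ) :
    (runBond (corner c.src) c.dir n).translate (halfDiag P j P.L) = line c n := by
  rw [line, lineSite_eq_runSite_corner]
  rfl

/-- kernel: `AveragingRT.pathProd` along the centred line of `c` is p11's `runProd` of the translated field along print's run from the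
corner. [cite: BalabanImbrieJaffe1988, (4.4) p.274] -/
theorem pathProd_eq_runProd_translate (U : GaugeField P j U1) (c : PBond P (j + 1)) :
    ∀ n : ℕ, pathProd U c n = runProd (U.translate (halfDiag P j P.L)) (corner c.src) c.dir n
  | 0 => rfl
  | n + 1 => by
    rw [runProd, ← pathProd_eq_runProd_translate U c n, GaugeField.translate_apply, runBond_corner_translate_halfDiag]
    rfl

/-- **ONE LEVEL OF (4.4): CENTRED = CORNER ∘ HALF-BLOCK TRANSLATION** — for a `U(1)` field `u` on `T^{(j)}`, the tree's straight-line
product between block centres (`AveragingRT.axialAvg`, = `barU 1` at `j = 0`) is print's corner-line product `ū_c = u(Γ_{yy′})` (p11's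
`lineU`, [BalabanImbrieJaffe1985] (2.10)) of the translated field `τ_{halfDiag L}u`, `(τ_a u)(b) = u(b + a)`; every level `j`, no cast,
no range hypothesis. [cite: BalabanImbrieJaffe1988, (4.4) p.274] -/
theorem axialAvg_eq_lineU_translate (U : GaugeField P j U1) : axialAvg U = lineU (U.translate (halfDiag P j P.L)) :=
  funext fun c => pathProd_eq_runProd_translate U c P.L

/-- kernel: the two typed corner-line products coincide — `BIJ88BgInvariance416Torus.cornerLine = BIJ85BlockAveragesTorusK.lineU`.
[cite: BalabanImbrieJaffe1988, (4.4) p.274] -/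
theorem cornerLine_eq_lineU (U : GaugeField P j U1) : cornerLine U = lineU U := by
  funext c
  apply toC_injective_U1
  rw [toC_cornerLine, toC_lineU]

/-- **the two typed corner ITERATES coincide**: `barUc k u = lineIter u k` (print's (4.4) in the corner convention, typed twice).
[cite: BalabanImbrieJaffe1988, (4.4) p.274] -/
theorem barUc_eq_lineIter : ∀ (k : ℕ) (U : GaugeField P j U1), barUc k U = lineIter U k
  | 0, _ => rfl
  | k + 1, U => by rw [barUc_succ, lineIter_succ, barUc_eq_lineIter k U, cornerLine_eq_lineU]

/-- kernel: one level in the `barUc` currency, `axialAvg u = cornerLine (τ_{halfDiag L}u)`. [cite: BalabanImbrieJaffe1988, (4.4) p.274] -/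
theorem axialAvg_eq_cornerLine_translate (U : GaugeField P j U1) : axialAvg U = cornerLine (U.translate (halfDiag P j P.L)) := by
  rw [cornerLine_eq_lineU, axialAvg_eq_lineU_translate]

/-! ## §3 Translation covariance of the line maps: a coarse translation is a fine translation by `corner a` -/

/-- **`ū` of a translated field**: `lineU (τ_{corner a}u) = τ_a(lineU u)` — translating the fine field by the fine vector `corner a`
(label `L·a`) translates the coarse line field by `a`; the corner-convention twin of the T4 cell's `AveragingRT.axialAvg_translate`
(centred lines, `Site.scale a` = `corner a`). [cite: BalabanImbrieJaffe1988, (4.4) p.274] -/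
theorem lineU_translate (U : GaugeField P j U1) (a : Balaban1983to89.Site P (j + 1)) :
    lineU (U.translate (corner a)) = (lineU U).translate a := by
  funext c
  show runProd (U.translate (corner a)) (corner c.src) c.dir P.L = runProd U (corner (c.translate a).src) (c.translate a).dir P.L
  rw [runProd_translate, PBond.translate_src, PBond.translate_dir, corner_add]

/-- kernel: the centred twin in r18's currency — `axialAvg (τ_{corner a}U) = τ_a(axialAvg U)`, any gauge group (the T4 cell's
`AveragingRT.axialAvg_translate` read through `corner = Site.scale`). [cite: BalabanImbrieJaffe1988, (4.4) p.274] -/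
theorem axialAvg_translate_corner {G : Type*} [GaugeGroup G] (U : GaugeField P j G) (a : Balaban1983to89.Site P (j + 1)) :
    axialAvg (U.translate (corner a)) = (axialAvg U).translate a := by
  rw [corner_eq_scale, AveragingRT.axialAvg_translate]

/-- **TRANSLATION COVARIANCE OF THE `k`-FOLD CORNER PRODUCT**: `lineIter (τ_{cornerIter k a}u) k = τ_a(lineIter u k)` — a translation
of `T^{(j+k)}` by `a` is the translation of `T^{(j)}` by the fine vector `cornerIter k a` of label `L^k·a` (every `k`; the corner twin
of the T4 cell's `T4Continuum.iter_translate`). [cite: BalabanImbrieJaffe1988, (4.4) p.274] -/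
theorem lineIter_translate : ∀ (k : ℕ) (U : GaugeField P j U1) (a : Balaban1983to89.Site P (j + k)),
    lineIter (U.translate (cornerIter k a)) k = (lineIter U k).translate a
  | 0, _, _ => rfl
  | k + 1, U, a => by
    rw [lineIter_succ, lineIter_succ, cornerIter_succ, lineIter_translate k U (corner a), lineU_translate]

/-! ## §4 The `k`-fold dictionary for (4.4): `barU k u = lineIter (τ_{halfDiag(L^k)} u) k` up to level transport -/

/-- kernel: p33's level transport `lvl` commutes with the one-level centred product (any equality of levels). [cite: BalabanImbrieJaffe1988, (4.4) p.274] -/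
theorem axialAvg_lvl {G : Type*} [GaugeGroup G] {n n' : ℕ} (e : n = n') (V : GaugeField P n G) :
    axialAvg (lvl e V) = lvl (congrArg Nat.succ e) (axialAvg V) := by
  subst e
  rfl

/-- kernel: `lvl` evaluated — `(lvl e V)(b) = V(b′)` with `b′` the same bond read at the level `n` (cast along `e`).
[cite: BalabanImbrieJaffe1988, (4.4) p.274] -/
theorem lvl_apply {G : Type*} {n n' : ℕ} (e : n = n') (V : GaugeField P n G) (b : PBond P n') :
    lvl e V b = V (cast (congrArg (PBond P) e.symm) b) := by
  subst e
  rfl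

/-- **THE DICTIONARY FOR (4.4), `k` LEVELS** (*"ū_{k,b} = u_k(⟨b₋, b₊⟩)"*): for every `U(1)` field `u` on `T_η` and every `k ≤ m + K`,
r18's centred `k`-fold product IS print's corner `k`-fold product (p11's `lineIter`) OF THE FIELD TRANSLATED BY THE HALF DIAGONAL OF AN
`L^k`-BLOCK, up to p33's level transport `0 + k ↔ k`:
`barU k u = lvl (Nat.zero_add k) (lineIter (τ_{halfDiag (L^k)} u) k)` — induction on `k` by §2 (`axialAvg = lineU ∘ τ_{halfDiag L}` at
the level `0 + k`), §3 (`τ` through `lineIter`) and §1 (`L^k·(L−1)/2 + (L^k−1)/2 = (L^{k+1}−1)/2`). [cite: BalabanImbrieJaffe1988, (4.4) p.274] -/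
theorem barU_eq_lvl_lineIter : ∀ (k : ℕ) (U : GaugeField P 0 U1),
    barU k U = lvl (Nat.zero_add k) (lineIter (U.translate (halfDiag P 0 (P.L ^ k))) k)
  | 0, U => by
    rw [pow_zero, halfDiag_one, GaugeField.translate_zero]
    rfl
  | k + 1, U => by
    rw [barU_succ, barU_eq_lvl_lineIter k U, axialAvg_lvl, axialAvg_eq_lineU_translate,
      ← lineIter_translate k (U.translate (halfDiag P 0 (P.L ^ k))) (halfDiag P (0 + k) P.L),
      GaugeField.translate_translate, cornerIter_halfDiag_add_halfDiag k, ← lineIter_succ]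

/-- **the same in the `barUc` currency**: `barU k u = lvl (Nat.zero_add k) (barUc k (τ_{halfDiag (L^k)} u))` — r18's centred (4.4) is the
corner (4.4) of `BIJ88BgInvariance416Torus` at the translated field. [cite: BalabanImbrieJaffe1988, (4.4) p.274] -/
theorem barU_eq_lvl_barUc (k : ℕ) (U : GaugeField P 0 U1) :
    barU k U = lvl (Nat.zero_add k) (barUc k (U.translate (halfDiag P 0 (P.L ^ k)))) := by
  rw [barUc_eq_lineIter, barU_eq_lvl_lineIter k]

/-- **(4.4) pointwise through the dictionary**: for a bond `b` of `T₁^{(k)}`, `ū_{k,b}` (r18's `barU`) is p11's corner product of the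
translated field at the same bond read at the level `0 + k`. [cite: BalabanImbrieJaffe1988, (4.4) p.274] -/
theorem barU_apply_eq_lineIter (k : ℕ) (U : GaugeField P 0 U1) (b : PBond P k) :
    barU k U b = lineIter (U.translate (halfDiag P 0 (P.L ^ k))) k (cast (congrArg (PBond P) (Nat.zero_add k).symm) b) := by
  rw [barU_eq_lvl_lineIter k, lvl_apply]

/-! ## §5 The dictionary read at the level `0 + k`, and for the covariant block averages `Q(ū_k)φ` of (3.11)/(5.1.1)/(6.1) -/

/-- kernel: `lvl` evaluated at a bond read at the source level — `(lvl e V)(b read at n′) = V(b)`. [cite: BalabanImbrieJaffe1988, (4.4) p.274] -/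
theorem lvl_apply_cast {G : Type*} {n n' : ℕ} (e : n = n') (V : GaugeField P n G) (b : PBond P n) :
    lvl e V (cast (congrArg (PBond P) e) b) = V b := by
  subst e
  rfl

/-- **(4.4) pointwise, read at the level `0 + k`** (the currency of p11's `lineIter`, p33's `vK`, p30 gen 33's `Step61`): print's corner
product of the translated field at a bond `b′` of `T^{(0+k)}` is r18's `ū_k` at the same bond read at the level `k`.
[cite: BalabanImbrieJaffe1988, (4.4) p.274] -/
theorem lineIter_translate_halfDiag_apply (k : ℕ) (U : GaugeField P 0 U1) (b' : PBond P (0 + k)) :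
    lineIter (U.translate (halfDiag P 0 (P.L ^ k))) k b' = barU k U (cast (congrArg (PBond P) (Nat.zero_add k)) b') := by
  rw [barU_eq_lvl_lineIter k, lvl_apply_cast]

/-- kernel: r18's covariant block average (2.6) `qCov` through p33's level transport — transporting the transporting field is
transporting the scalar field and the coarse site instead (any equality of levels). [cite: BalabanImbrieJaffe1985, (2.6) p.303] -/
theorem qCov_lvl {n n' : ℕ} (e : n = n') (W : GaugeField P n U1) (φ : BIJ85Sect1Model.HiggsField P n')
    (y : Balaban1983to89.Site P (n' + 1)) :
    BIJ85BlockAveragesTorus.qCov (lvl e W) φ y =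
      BIJ85BlockAveragesTorus.qCov W (fun x => φ (cast (congrArg (Balaban1983to89.Site P) e) x))
        (cast (congrArg (fun i => Balaban1983to89.Site P (i + 1)) e.symm) y) := by
  subst e
  rfl

/-- **THE CONSUMER LINE FOR ROWS C2.Eq3.11 / (5.1.1) VERSUS C1.Eq6.1-6.4**: p34's record of *"Q(u_k)φ"* ([BalabanImbrieJaffe1988] (3.11),
(5.1.1): `qCov (barU k u_k) φ`, level `k → k + 1`) equals the (6.1) shape `qCov (lineIter · k) ·` of p30 gen 33's `BIJ85Eq61MeanFieldRT.Step61.qH`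
(level `0 + k → 0 + k + 1`) AT THE TRANSLATED BACKGROUND `τ_{halfDiag (L^k)}u_k`, the scalar field and the coarse site being read through
the level casts (r13's `siteK` is `cast (congrArg (Site P) (Nat.zero_add k))`).  The two records are NOT asserted equal at the same
background. [cite: BalabanImbrieJaffe1988, (3.11) p.266] -/
theorem qCov_barU_eq_qCov_lineIter_translate (k : ℕ) (V : GaugeField P 0 U1)
    (φ : BIJ85Sect1Model.HiggsField P k) (y : Balaban1983to89.Site P (k + 1)) :
    BIJ85BlockAveragesTorus.qCov (barU k V) φ y =
      BIJ85BlockAveragesTorus.qCov (lineIter (V.translate (halfDiag P 0 (P.L ^ k))) k)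
        (fun x => φ (cast (congrArg (Balaban1983to89.Site P) (Nat.zero_add k)) x))
        (cast (congrArg (fun i => Balaban1983to89.Site P (i + 1)) (Nat.zero_add k).symm) y) := by
  rw [barU_eq_lvl_lineIter k V, qCov_lvl]

end

end Literature.MathematicalPhysics.QuantumFieldTheory.BalabanImbrieJaffe1984to88.BIJ88Eq44CornerCentre
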